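import Literature.Claims.NS.PereiraSilva2025
import Summits.NavierStokesRegularity.NavierStokesRegularity.Theorems.SoloRefuteLucardoOlivaes2026
import Literature.Analysis.FluidPDE.NSLerayHopfSereginEnergyProofs
import Mathlib.MeasureTheory.Measure.Lebesgue.EqHaar
import Summits.NavierStokesRegularity.NavierStokesRegularity.Theorems.TypeILiouvilleTypeIliouvilleNoTypeIIStubThreeFifthsLawCurl
import HarnessLib

/-!
# C149 `PereiraSilva2025` — refuter kit (ns-claims-refuter-1 g4, refuter of record)

Skeleton of record: `Literature/Claims/NS/PereiraSilva2025.lean` (typist-8 g6, p525554, sha16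
c74a24cbf7f5b347). Text of record: Zenodo 15214381 (PDF 57231ced7d5b10c1, 6 pp.), census pin
`census/texts/PereiraSilva2025/`.

Kernel objects (every `K : Consts`, i.e. for ALL values of the paper's constants `C_G, C, C_P > 0`):
* `not_Step32_PoincareSol K : ¬ Step32_PoincareSol K` — p.3 l.165 «Using Poincaré's inequality,
  ‖∇ω‖² ≥ C_P S» along the solution (binder 2 of `claim_of_steps`, the print-earliest consumed binder
  killed here): at `t = 0` of the Chae/BKM local solution (tree: `exists_isLocalSolution`, Majda–Bertozzi
  Thm 3.4) from the dilated datum `x ↦ u0(c x)`, `c` small, packaged as a `SlabSol` on `[0, T/2)`.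
* `not_Step32_Proviso K : ¬ Step32_Proviso K` — p.3 l.167 «assuming ν > (1/3)C_G²C'_G E(0)^{1/6}», needed
  for every `ν > 0` and every datum: fails at `ν = 1` on the amplitude family `A • u0` (binder 3 of
  `claim_of_steps`).
* `not_Step33_Sign K : ¬ Step33_Sign K` — p.3 l.251–252 / p.4 l.12 «Assuming … k₁ − k₂ < 0»: the same datum
  gives `k₁ − k₂ > 0` (binder 4 of `claim_of_steps`).
Companion file `SoloRefutePereiraSilva2025Support.lean`: the functions-grain support displays
(`not_Step2_GN K`, `not_Step2_Poincare K`, `not_Step32_Young`).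
The datum `u0` is the tree's compactly supported divergence-free field of the C137 kit
(`SoloRefuteLucardoOlivaes2026`). [folklore]

WHAT THIS IS NOT: not a claim about NS regularity or blow-up; not a claim about any author beyond the
typed locator.
-/

set_option linter.dupNamespace false

noncomputable section

open Real Set Function MeasureTheory
open scoped ENNReal NNReal ContDiff

namespace Summit.NavierStokesRegularity.NavierStokesRegularity.Theorems.PereiraSilva2025

open Summit.NavierStokesRegularity.NavierStokesRegularity.Theorems.TypeIliouvilleNoTypeII.GradientPivot
  (curl_comp_smul) -- landed copy (dedup.landed fix-up by the filer; the kit's byte-identical lemma removed)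

open Literature.Analysis Literature.Analysis.FluidPDE
open Literature.Claims.NS.PereiraSilva2025
open Literature.Claims.NS.Chae2007 (IsDatum)
open Literature.Claims.NS.LucardoOlivaes2026 (E3 IsOuroDatum)
open Literature.Claims.NS.PaiLimsuwan2026 (SlabSol)
open Summit.NavierStokesRegularity.NavierStokesRegularity.Theorems.LucardoOlivaes2026
  (u0 isOuroDatum_u0 contDiff_u0 hasCompactSupport_u0 isDivFree_u0 ens_pos isDatum_smul curl_smul_fun
  exists_isLocalSolution)

/-! ## A. Change of variables under the dilation `x ↦ c x`, `c > 0` -/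

/-- `∫⁻ F(c x) dx = c⁻³ ∫⁻ F` on `ℝ³` (Mathlib `Measure.map_addHaar_smul`). [folklore] -/
theorem lintegral_comp_smul_fin3 (F : E3 → ℝ≥0∞) {c : ℝ} (hc : 0 < c) :
    ∫⁻ x, F (c • x) = ENNReal.ofReal ((c ^ 3)⁻¹) * ∫⁻ y, F y := by
  have hc0 : c ≠ 0 := hc.ne'
  have hemb : MeasurableEmbedding (fun x : E3 => c • x) :=
    (Homeomorph.smul (Units.mk0 c hc0)).measurableEmbedding
  calc ∫⁻ x, F (c • x) = ∫⁻ y, F y ∂(Measure.map (fun x : E3 => c • x) volume) := by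
        rw [hemb.lintegral_map]
    _ = ENNReal.ofReal ((c ^ 3)⁻¹) * ∫⁻ y, F y := by
        rw [Measure.map_addHaar_smul volume hc0, lintegral_smul_measure,
          finrank_euclideanSpace_fin, abs_of_nonneg (by positivity), smul_eq_mul]

/-- `∫ f(c x) dx = c⁻³ ∫ f` on `ℝ³`. [folklore] -/
theorem integral_comp_smul_fin3 (f : E3 → ℝ) {c : ℝ} (hc : 0 < c) :
    ∫ x, f (c • x) = (c ^ 3)⁻¹ * ∫ y, f y := by
  rw [Measure.integral_comp_smul volume f c, finrank_euclideanSpace_fin, smul_eq_mul,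
    abs_of_nonneg (by positivity)]

/-- kit lemma (plumbing) [folklore] -/ theorem curl_comp_smul_fun (v : E3 → E3) (c : ℝ) :
    curl (fun y => v (c • y)) = fun x => c • curl v (c • x) :=
  funext (curl_comp_smul v c)

/-- `∇(curl v(c ·))(x) = c² • (∇ curl v)(c x)`. [folklore] -/
theorem fderiv_curl_comp_smul (v : E3 → E3) (c : ℝ) (x : E3) :
    fderiv ℝ (curl (fun y => v (c • y))) x = (c * c) • fderiv ℝ (curl v) (c • x) := by
  rw [curl_comp_smul_fun]
  show fderiv ℝ (c • fun z => curl v (c • z)) x = _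
  rw [fderiv_const_smul_field, Pi.smul_apply, fderiv_comp_smul, smul_smul]

/-- Enstrophy: `∫|curl v(c·)|² = c⁻¹ ∫|curl v|²`. [folklore] -/
theorem l2sq_curl_comp_smul (v : E3 → E3) {c : ℝ} (hc : 0 < c) :
    l2sq (curl (fun y => v (c • y))) = c⁻¹ * l2sq (curl v) := by
  unfold l2sq
  simp_rw [curl_comp_smul, norm_smul, mul_pow]
  rw [integral_const_mul, integral_comp_smul_fin3 (fun y => ‖curl v y‖ ^ 2) hc, ← mul_assoc,
    Real.norm_eq_abs, abs_of_pos hc]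
  congr 1
  field_simp

/-- `gradsqF (curl v(c·)) = c · gradsqF (curl v)`. [folklore] -/
theorem gradsqF_curl_comp_smul (v : E3 → E3) {c : ℝ} (hc : 0 < c) :
    gradsqF (curl (fun y => v (c • y))) = c * gradsqF (curl v) := by
  unfold gradsqF
  simp_rw [fderiv_curl_comp_smul, FunLike.coe_smul, Pi.smul_apply, norm_smul, mul_pow, ← Finset.mul_sum]
  rw [integral_const_mul, integral_comp_smul_fin3
    (fun y => ∑ j : Fin 3, ‖fderiv ℝ (curl v) y (EuclideanSpace.single j 1)‖ ^ 2) hc, ← mul_assoc,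
    Real.norm_eq_abs, abs_of_nonneg (mul_self_nonneg c)]
  congr 1
  field_simp

/-! ## B. The datum `u0` and its dilates / multiples are in the paper's data class -/

/-- The Chae/BKM data class is dilation invariant. [folklore] -/
theorem isDatum_comp_smul {v : E3 → E3} (hv : IsDatum v) {c : ℝ} (hc : 0 < c) :
    IsDatum (fun x => v (c • x)) := by
  obtain ⟨hs, hdiv, hfin⟩ := hv
  refine ⟨hs.comp (contDiff_const_smul c), ?_, ?_⟩
  · intro x
    have hx := hdiv (c • x)
    simp only [VectorCalculus.divergence] at hx ⊢
    rw [fderiv_comp_smul, ContinuousLinearMap.toLinearMap_smul, map_smul, hx, smul_zero]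
  · intro n
    have hpt : ∀ x, ‖iteratedFDeriv ℝ n (fun y => v (c • y)) x‖ₑ ≤
        ENNReal.ofReal (|c| ^ n) * ‖iteratedFDeriv ℝ n v (c • x)‖ₑ := by
      intro x
      have key := ContinuousLinearMap.iteratedFDeriv_comp_right (c • ContinuousLinearMap.id ℝ E3)
        hs x (i := n) (by exact_mod_cast le_top)
      have hfun : (v ∘ ⇑(c • ContinuousLinearMap.id ℝ E3)) = fun y => v (c • y) := by
        funext y; simp
      have hxeq : (c • ContinuousLinearMap.id ℝ E3) x = c • x := by simp
      rw [hfun, hxeq] at key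
      rw [key, ← ofReal_norm, ← ofReal_norm, ← ENNReal.ofReal_mul (by positivity)]
      refine ENNReal.ofReal_le_ofReal ?_
      refine (ContinuousMultilinearMap.norm_compContinuousLinearMap_le _ _).trans ?_
      simp only [Finset.prod_const, Finset.card_univ, Fintype.card_fin]
      have hnorm : ‖c • ContinuousLinearMap.id ℝ E3‖ ≤ |c| := by
        rw [norm_smul, Real.norm_eq_abs]
        exact mul_le_of_le_one_right (abs_nonneg _) ContinuousLinearMap.norm_id_le
      rw [mul_comm]
      gcongr
    have hle : ∫⁻ x, ‖iteratedFDeriv ℝ n (fun y => v (c • y)) x‖ₑ ^ 2 ≤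
        ENNReal.ofReal (|c| ^ n) ^ 2 * ∫⁻ x, ‖iteratedFDeriv ℝ n v (c • x)‖ₑ ^ 2 := by
      rw [← lintegral_const_mul' _ _ (by finiteness)]
      refine lintegral_mono fun x => ?_
      rw [← mul_pow]
      exact pow_le_pow_left' (hpt x) 2
    refine hle.trans_lt ?_
    rw [lintegral_comp_smul_fin3 (fun y => ‖iteratedFDeriv ℝ n v y‖ₑ ^ 2) hc]
    exact ENNReal.mul_lt_top (by simp) (ENNReal.mul_lt_top ENNReal.ofReal_lt_top (hfin n))


/-- A Chae/BKM local solution from a datum of the paper's class is a `SlabSol` on the half slab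
`[0, T/2)` (finite energy from the `n = 0` Sobolev bound on `[0, T/2]`). [folklore] -/
theorem slabSol_of_isLocalSolution {ν T : ℝ} {v₀ : E3 → E3} {u : ℝ → E3 → E3} {p : ℝ → E3 → ℝ}
    (hν : 0 < ν) (hT : 0 < T) (hs : ContDiff ℝ ∞ v₀) (hdiv : NSWave0.IsDivFree v₀)
    (hdec : HasRapidSpatialDecay v₀) (h : Literature.Claims.NS.Chae2007.IsLocalSolution ν T v₀ u p) :
    SlabSol ν (T / 2) v₀ u p := by
  obtain ⟨C, hC⟩ := h.sobolev (T / 2) (by linarith) 0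
  refine ⟨hν, hs, hdiv, hdec, h.isClassical.mono (Ico_subset_Ico_right (by linarith))
    (uniqueDiffOn_Ico 0 (T / 2)), h.initial, ⟨C, ENNReal.coe_lt_top, fun t ht => ?_⟩⟩
  calc ∫⁻ x, ‖u t x‖ₑ ^ 2 = ∫⁻ x, ‖iteratedFDeriv ℝ 0 (u t) x‖ₑ ^ 2 := by
        refine lintegral_congr fun x => ?_
        rw [← ofReal_norm, ← ofReal_norm (iteratedFDeriv ℝ 0 (u t) x), norm_iteratedFDeriv_zero]
    _ ≤ C := hC t (Ico_subset_Icc_self ht)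


/-- kit lemma (plumbing) [folklore] -/ theorem u0_ne_zero : u0 ≠ 0 := by
  intro h
  apply isOuroDatum_u0.2.2
  have : curl u0 = curl ((0 : ℝ) • u0) := by rw [zero_smul, h]
  rw [this, curl_smul_fun]
  funext x
  simp

/-- `∫|u0|^n > 0` (`n ≥ 1`). [folklore] -/
theorem integral_norm_u0_pow_pos (n : ℕ) (hn : n ≠ 0) : 0 < ∫ x, ‖u0 x‖ ^ n := by
  obtain ⟨x₀, hx₀⟩ := Function.ne_iff.1 u0_ne_zero
  have hc : Continuous fun x => ‖u0 x‖ ^ n := (contDiff_u0.continuous.norm).pow n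
  have hcs : HasCompactSupport fun x => ‖u0 x‖ ^ n :=
    (hasCompactSupport_u0.norm).comp_left (g := fun r : ℝ => r ^ n) (by simp [hn])
  have h0 : (fun x => ‖u0 x‖ ^ n) x₀ ≠ 0 := by simpa [hn] using hx₀
  exact hc.integral_pos_of_hasCompactSupport_nonneg_nonzero hcs (fun x => by positivity) h0

/-- kit lemma (plumbing) [folklore] -/ theorem contDiff_u0_comp_smul (c : ℝ) : ContDiff ℝ ∞ (fun y => u0 (c • y)) :=
  contDiff_u0.comp (contDiff_const_smul c)

/-- kit lemma (plumbing) [folklore] -/ theorem hasCompactSupport_u0_comp_smul {c : ℝ} (hc : c ≠ 0) :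
    HasCompactSupport (fun y => u0 (c • y)) :=
  hasCompactSupport_u0.comp_smul hc

/-- kit lemma (plumbing) [folklore] -/ theorem decay_u0_comp_smul {c : ℝ} (hc : c ≠ 0) : HasRapidSpatialDecay (fun y => u0 (c • y)) :=
  HasRapidSpatialDecay.of_hasCompactSupport (contDiff_u0_comp_smul c) (hasCompactSupport_u0_comp_smul hc)

/-- kit lemma (plumbing) [folklore] -/ theorem divFree_u0_comp_smul (c : ℝ) : NSWave0.IsDivFree (fun y => u0 (c • y)) := by
  intro x
  have hx := isDivFree_u0 (c • x)
  simp only [VectorCalculus.divergence] at hx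
  simp only [NSWave0.divergence]
  rw [fderiv_comp_smul, ContinuousLinearMap.toLinearMap_smul, map_smul, hx, smul_zero]

/-- kit lemma (plumbing) [folklore] -/ theorem contDiff_smul_u0 (A : ℝ) : ContDiff ℝ ∞ (fun x => A • u0 x) :=
  contDiff_u0.const_smul A

/-- kit lemma (plumbing) [folklore] -/ theorem decay_smul_u0 (A : ℝ) : HasRapidSpatialDecay (fun x => A • u0 x) :=
  Literature.Claims.NS.ClayVariants.hasRapidSpatialDecay_const_smul contDiff_u0
    (HasRapidSpatialDecay.of_hasCompactSupport contDiff_u0 hasCompactSupport_u0) A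

/-- kit lemma (plumbing) [folklore] -/ theorem divFree_smul_u0 (A : ℝ) : NSWave0.IsDivFree (fun x => A • u0 x) := by
  have h : VectorCalculus.IsDivFree (A • u0) := (isDatum_smul isOuroDatum_u0.1 A).2.1
  exact h

/-- `E(A·u0) = A² E(u0)`. [folklore] -/
theorem En₀_smul_u0 (A : ℝ) : En₀ (fun x => A • u0 x) = A ^ 2 * En₀ u0 := by
  unfold En₀
  simp_rw [norm_smul, mul_pow, integral_const_mul, Real.norm_eq_abs, sq_abs]
  ring

/-- kit lemma (plumbing) [folklore] -/ theorem En₀_u0_pos : 0 < En₀ u0 := by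
  unfold En₀
  have := integral_norm_u0_pow_pos 2 two_ne_zero
  positivity

/-! ## C. Real-variable helpers -/

/-- kit lemma (plumbing) [folklore] -/ theorem rpow_third_pow_six {x : ℝ} (hx : 0 ≤ x) : (x ^ ((1 : ℝ) / 3)) ^ 6 = x ^ 2 := by
  rw [← Real.rpow_natCast, ← Real.rpow_mul hx]
  norm_num

/-- kit lemma (plumbing) [folklore] -/ theorem rpow_sixth_pow_six {x : ℝ} (hx : 0 ≤ x) : (x ^ ((1 : ℝ) / 6)) ^ 6 = x := by
  rw [← Real.rpow_natCast, ← Real.rpow_mul hx]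
  norm_num

/-- `(M⁶)^{1/6} = M` for `M ≥ 0`. [folklore] -/
theorem rpow_sixth_of_pow_six {M : ℝ} (hM : 0 ≤ M) : (M ^ 6) ^ ((1 : ℝ) / 6) = M := by
  rw [← Real.rpow_natCast, ← Real.rpow_mul hM]
  norm_num

/-- `a (3/a + 1) = 3 + a` for `a ≠ 0`. -/
theorem mul_three_div_add_one {a : ℝ} (ha : a ≠ 0) : a * (3 / a + 1) = 3 + a := by
  field_simp

/-- kit lemma (plumbing) [folklore] -/ theorem CG'_pos (K : Consts) : 0 < K.CG' := by
  unfold Consts.CG'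
  have h1 := K.CG_pos
  have h2 : 0 < (2 : ℝ) ^ (1 / 6 : ℝ) := Real.rpow_pos_of_pos two_pos _
  have h3 : 0 < K.C ^ (1 / 3 : ℝ) := Real.rpow_pos_of_pos K.C_pos _
  positivity

/-- The amplitude `A(K)` with `E(A·u0)^{1/6} = 3/(C_G²C'_G) + 1`. -/
def Mbig (K : Consts) : ℝ := 3 / (K.CG ^ 2 * K.CG') + 1

/-- kit lemma (plumbing) [folklore] -/ def Abig (K : Consts) : ℝ := Mbig K ^ 3 / Real.sqrt (En₀ u0)

/-- kit lemma (plumbing) [folklore] -/ theorem Mbig_pos (K : Consts) : 0 < Mbig K := by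
  unfold Mbig
  have := K.CG_pos
  have := CG'_pos K
  positivity

/-- kit lemma (plumbing) [folklore] -/ theorem En₀_Abig (K : Consts) : En₀ (fun x => Abig K • u0 x) = Mbig K ^ 6 := by
  rw [En₀_smul_u0]
  unfold Abig
  have he := En₀_u0_pos
  have hs : Real.sqrt (En₀ u0) ^ 2 = En₀ u0 := Real.sq_sqrt he.le
  have hs0 : 0 < Real.sqrt (En₀ u0) := Real.sqrt_pos.2 he
  field_simp
  rw [hs]

/-- kit lemma (plumbing) [folklore] -/ theorem En₀_Abig_sixth (K : Consts) : En₀ (fun x => Abig K • u0 x) ^ ((1 : ℝ) / 6) = Mbig K := by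
  rw [En₀_Abig, rpow_sixth_of_pow_six (Mbig_pos K).le]

/-- The scaling arithmetic shared by the two Poincaré kills: with `c = min 1 (C_P E / (2(P+1)))`,
`C_P (c⁻¹ E) ≤ c P` is impossible (`E > 0`, `P ≥ 0`, `C_P > 0`). -/
theorem poincare_scaling_absurd {CP E P c : ℝ} (hCP : 0 < CP) (hE : 0 < E) (hP : 0 ≤ P)
    (hc : c = min 1 (CP * E / (2 * (P + 1)))) (key : CP * (c⁻¹ * E) ≤ c * P) : False := by
  have hcpos : 0 < c := by rw [hc]; exact lt_min one_pos (by positivity)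
  have hc1 : c ≤ 1 := by rw [hc]; exact min_le_left _ _
  have hc2 : c ≤ CP * E / (2 * (P + 1)) := by rw [hc]; exact min_le_right _ _
  have k1 : CP * E ≤ c ^ 2 * P := by
    have := mul_le_mul_of_nonneg_left key hcpos.le
    have e1 : c * (CP * (c⁻¹ * E)) = CP * E := by field_simp
    have e2 : c * (c * P) = c ^ 2 * P := by ring
    rwa [e1, e2] at this
  have k2 : c ^ 2 * P ≤ c * P := by
    have : 0 ≤ c * P * (1 - c) := mul_nonneg (mul_nonneg hcpos.le hP) (sub_nonneg.2 hc1)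
    nlinarith [this]
  have k3 : c * P ≤ CP * E / (2 * (P + 1)) * P := mul_le_mul_of_nonneg_right hc2 hP
  have k4 : CP * E / (2 * (P + 1)) * P < CP * E := by
    rw [div_mul_eq_mul_div, div_lt_iff₀ (by positivity)]
    nlinarith [mul_pos hCP hE]
  linarith

/-! ## D. The kills -/

/-- **`¬ Step32_Proviso K` (p.3 l.167)**, every `K`: at `ν = 1` the datum `A(K)·u0` has
`(1/3)C_G²C'_G E(0)^{1/6} = 1 + (1/3)C_G²C'_G > 1`. [cite: PereiraSilva2025, p.3 l.167] -/
theorem not_Step32_Proviso (K : Consts) : ¬ Step32_Proviso K := by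
  intro h
  have key := h 1 one_pos (fun x => Abig K • u0 x) (contDiff_smul_u0 _) (divFree_smul_u0 _)
    (decay_smul_u0 _)
  rw [show (1 / 6 : ℝ) = (1 : ℝ) / 6 by norm_num, En₀_Abig_sixth] at key
  unfold Mbig at key
  have hc : 0 < K.CG ^ 2 * K.CG' := mul_pos (pow_pos K.CG_pos 2) (CG'_pos K)
  have e : (1 / 3) * K.CG ^ 2 * K.CG' * (3 / (K.CG ^ 2 * K.CG') + 1) =
      (1 / 3) * ((K.CG ^ 2 * K.CG') * (3 / (K.CG ^ 2 * K.CG') + 1)) := by ring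
  rw [e, mul_three_div_add_one hc.ne'] at key
  linarith

/-- **`¬ Step33_Sign K` (p.3 l.251–252, p.4 l.12)**, every `K`: at `ν = 1` the same datum has
`k₁ − k₂ = 2 + (2/3)C_G²C'_G + (1/3)C_G²C'_G·C_P > 0`. [cite: PereiraSilva2025, p.3 l.251–252] -/
theorem not_Step33_Sign (K : Consts) : ¬ Step33_Sign K := by
  intro h
  have key := h 1 one_pos (fun x => Abig K • u0 x) (contDiff_smul_u0 _) (divFree_smul_u0 _)
    (decay_smul_u0 _)
  unfold k1 k2 at key
  rw [show (1 / 6 : ℝ) = (1 : ℝ) / 6 by norm_num, En₀_Abig_sixth] at key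
  unfold Mbig at key
  have hc : 0 < K.CG ^ 2 * K.CG' := mul_pos (pow_pos K.CG_pos 2) (CG'_pos K)
  have hP := K.CP_pos
  have h1 : K.CG ^ 2 * K.CG' * (3 / (K.CG ^ 2 * K.CG') + 1) = 3 + K.CG ^ 2 * K.CG' :=
    mul_three_div_add_one hc.ne'
  have : (2 / 3) * K.CG ^ 2 * K.CG' * (3 / (K.CG ^ 2 * K.CG') + 1) -
      (1 * K.CP - (1 / 3) * K.CG ^ 2 * K.CG' * (3 / (K.CG ^ 2 * K.CG') + 1) * K.CP) =
      2 + (2 / 3) * (K.CG ^ 2 * K.CG') + (1 / 3) * (K.CG ^ 2 * K.CG') * K.CP := by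
    have e1 : (2 / 3) * K.CG ^ 2 * K.CG' * (3 / (K.CG ^ 2 * K.CG') + 1) =
        (2 / 3) * (K.CG ^ 2 * K.CG' * (3 / (K.CG ^ 2 * K.CG') + 1)) := by ring
    have e2 : (1 / 3) * K.CG ^ 2 * K.CG' * (3 / (K.CG ^ 2 * K.CG') + 1) * K.CP =
        (1 / 3) * (K.CG ^ 2 * K.CG' * (3 / (K.CG ^ 2 * K.CG') + 1)) * K.CP := by ring
    rw [e1, e2, h1]
    ring
  rw [this] at key
  nlinarith [mul_pos hc hP]

/-- **`¬ Step32_PoincareSol K` (p.3 l.165 «Using Poincaré's inequality, ‖∇ω‖² ≥ C_P S»)**, every `K`,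
binder 2 of `claim_of_steps`: at `t = 0` along the Chae/BKM local solution (`ν = 1`) from the dilated
datum `x ↦ u0(c x)` the display reads `C_P c⁻¹ ∫|curl u0|² ≤ c · gradsqF (curl u0)`, false for `c`
small. [cite: PereiraSilva2025, p.3 l.165] -/
theorem not_Step32_PoincareSol (K : Consts) : ¬ Step32_PoincareSol K := by
  intro h
  have hE := ens_pos isOuroDatum_u0
  set E : ℝ := ∫ x, ‖curl u0 x‖ ^ 2 with hEdef
  set P : ℝ := gradsqF (curl u0) with hPdef
  have hP : 0 ≤ P := integral_nonneg fun x => Finset.sum_nonneg fun j _ => by positivity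
  have hCP := K.CP_pos
  set c : ℝ := min 1 (K.CP * E / (2 * (P + 1))) with hc
  have hcpos : 0 < c := lt_min one_pos (by positivity)
  obtain ⟨T, hT, u, p, hloc⟩ :=
    exists_isLocalSolution one_pos.le (isDatum_comp_smul isOuroDatum_u0.1 hcpos)
  have hS : SlabSol 1 (T / 2) (fun x => u0 (c • x)) u p :=
    slabSol_of_isLocalSolution one_pos hT (contDiff_u0_comp_smul c) (divFree_u0_comp_smul c)
      (decay_u0_comp_smul hcpos.ne') hloc
  have key := h 1 (T / 2) _ u p hS 0 ⟨le_rfl, by linarith⟩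
  unfold Ens G at key
  rw [hloc.initial] at key
  have e1 : (∫ x, ‖curl (fun x => u0 (c • x)) x‖ ^ 2) = c⁻¹ * E := by
    have := l2sq_curl_comp_smul u0 hcpos
    unfold l2sq at this
    rw [this]
  rw [e1, gradsqF_curl_comp_smul u0 hcpos, ← hPdef] at key
  exact poincare_scaling_absurd hCP hE hP hc key

/-! ## FQN guards -/

example (K : Literature.Claims.NS.PereiraSilva2025.Consts) :
    ¬ Literature.Claims.NS.PereiraSilva2025.Step32_Proviso K := not_Step32_Proviso K
example (K : Literature.Claims.NS.PereiraSilva2025.Consts) :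
    ¬ Literature.Claims.NS.PereiraSilva2025.Step33_Sign K := not_Step33_Sign K
example (K : Literature.Claims.NS.PereiraSilva2025.Consts) :
    ¬ Literature.Claims.NS.PereiraSilva2025.Step32_PoincareSol K := not_Step32_PoincareSol K

/-- info: 'Summit.NavierStokesRegularity.NavierStokesRegularity.Theorems.PereiraSilva2025.not_Step32_PoincareSol' depends on axioms: [propext,
 Classical.choice,
 Quot.sound] -/
#guard_msgs in
#print axioms Summit.NavierStokesRegularity.NavierStokesRegularity.Theorems.PereiraSilva2025.not_Step32_PoincareSol

/-- info: 'Summit.NavierStokesRegularity.NavierStokesRegularity.Theorems.PereiraSilva2025.not_Step32_Proviso' depends on axioms: [propext,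
 Classical.choice,
 Quot.sound] -/
#guard_msgs in
#print axioms Summit.NavierStokesRegularity.NavierStokesRegularity.Theorems.PereiraSilva2025.not_Step32_Proviso

/-- info: 'Summit.NavierStokesRegularity.NavierStokesRegularity.Theorems.PereiraSilva2025.not_Step33_Sign' depends on axioms: [propext,
 Classical.choice,
 Quot.sound] -/
#guard_msgs in
#print axioms Summit.NavierStokesRegularity.NavierStokesRegularity.Theorems.PereiraSilva2025.not_Step33_Sign

end Summit.NavierStokesRegularity.NavierStokesRegularity.Theorems.PereiraSilva2025

end
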